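import Summits.QuantumFields.BalabanUV.T4Continuum.Support.VariationalColourTaxiTowerProjGAvgGRate
import Summits.QuantumFields.BalabanUV.T4Continuum.Support.VariationalColourTaxiTowerCentred
import Summits.QuantumFields.BalabanUV.T4Continuum.Support.VariationalColourTaxiTowerOneMinDecay

/-!
# T⁴ programme, spine node NE2 (U1a), lane P2 — «V-AVG-G AT TAXI DATA», file 9: THE VECTOR END WITH RATE AT BAŁABAN's TAXI DATA FOR THE COVARIANT
# PROJECTED GAUGE FUNCTIONAL WITH NO DISPLAYED (ONE-min) LEAF — file 4 ∘ leaf-04-g7's `hONEm_taxi` ∘ file 8's decay (model level; cell `pub-balaban`)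

NE2 formalisation swarm `b2b-balaban-t4-ne2-formalise-*`, leaf prover 10 GEN 5 (`prover-b2b-balaban-t4-ne2-formalise-leaf-10-g5-0`, V-END holder lineage; staged
23:46Z, filed unchanged in content by GEN 6 `prover-b2b-balaban-t4-ne2-formalise-leaf-10-g6-0`, ONLINE l.24052); item «V-AVG-G AT TAXI DATA», file 9 = the JUNCTION
announced in journal NOTE l.22515 (ne5-leaf-04's §K adapter, GAPS C-ne5leaf04-27, read the socket).  Composition BY NAME:
 * file 4 `VariationalColourTaxiTowerProjGAvgGRate.towerLimitRate_effV_taxiTower_projG_avgG_of_class` (p239250): the RATE END at taxi data for `projG` with NO slice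
   law, displaying only (ONE-min)_k with a generic V-REG size `ρV`;
 * leaf-04-g7's `VariationalColourTaxiTowerCentred.hONEm_taxi` (p238755): (ONE-min)_k WITH BACKGROUND at Bałaban's taxi data (composite fibre ↔ taxi frames), read at
   `ρV := ScV(G_k ·) + nsqV ∘ Q_k`, V-REG constant `C_R = 1` (the `subst` adapter), its costs `ε₁,k = (A−1) + A·ε + B`, `δ′₁,k = √A·δ′` an explicit `let` telescope;
 * file 8 `VariationalColourTaxiTowerOneMinDecay.oneMin_taxi_decay` (p243149): those costs, with the five free parameters `:= θ^k`, are `≤ C·θ^k` under the class (files 6 ∕ 7 ∕ 7b),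
   and the transfer smallness numbers obey `v ≤ V⋆`, `γ ≤ Γ⋆`;
 * the per-level class lines `hONEm_taxi` wants: the package (`taxiClassPackage`), §1 here (`small80_of_class`, `smallP_succ_of_class`), file 8's
   `LambdaSucc_le_of_class` (.1: the level-(k+1) frames' nearness `< 1`), file 6's `kappa_gammaF_le_of_class` (`hcF`); (GF3)_k from part 7's
   `hGdiv_projG_nestLv_regular`, V-REG for `G` from part 8's `projG_sockets_nestLv`.
DISPLAYED (hypotheses, read them): file 4's data classes (one-step plaquette class `hbc`, coherence, `hsm1–hsm6`, regular presentation `har… hsmallQ`) + `hsm7` + the two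
transfer lines `hsmV`, `hsmG` (polynomial in `c`, spelled out) + THE COLOUR SCALAR PAIR's FIVE LEAVES AT THE TAXI FRAMES at every level with uniform constants `Λc, CPc,
CRc` (the remaining analytic input; supplier = leaf-04-g7's chain, their file 7) + `0 < θ < 1`, `L⁻¹ ≤ θ²`.  CONCLUSION: file 4's `TowerLimitRate … (eV … + ePV Λs CPs 1
Cε1 Cδ1) θ` with the explicit k-free constants `Cε1, Cδ1` (`let`s).  NO (ONE-min) ∕ (ONE-min-f) ∕ (G″) ∕ V-REG ∕ V-REG′ ∕ (GF3) hypothesis remains.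

HONEST FRAMING (T4-DAG p. 1).  Kernel composition at the model level (finite torus, fibre `ℂ`, our discrete forms); the smallness thresholds are quantitatively void
(memo GF3COV §3); θ carries the half exponent (`θ² ≥ L⁻¹`, file 2b).  V-END with background ∕ NE2 NOT proved: the colour scalar pair's leaves at the taxi frames are
DISPLAYED, and nothing here is Bałaban's (1.1)–(1.3) renormalisation flow; NE3 OPEN; spine PROVED 0∕9 unchanged; rung (B)+1 on a fixed finite T⁴ — NOT infinite volume,
NOT mass gap, NOT Clay.  No `def`, no `def … : Prop`, no `sorry`; axioms standard.  HONEST DEPENDENCY (cell, verbatim): continuum YM on T⁴ ⇐ BetaPertH ∧ nine spine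
estimates (0/9 proved); BetaPertH ⇐ (D1) ∧ (D4) ∧ CAP+tail; G-an2-4 gates asym, D1 and NE2/3/4.
-/

noncomputable section

namespace Summit.QuantumFields.BalabanUV.T4Continuum.VariationalColourTaxiTowerProjGRate

open Finset
open scoped Matrix ComplexOrder BigOperators
open Literature.MathematicalPhysics.QuantumFieldTheory.Balaban1983to89.B5Prop11Plancherel (Tor fine unitVec Cst)
open Literature.MathematicalPhysics.QuantumFieldTheory.Balaban1983to89.B5Composition116 (sites)
open Literature.Analysis.Complex (qform)
open Summit.QuantumFields.BalabanUV.T4Continuum.VariationalColourFederbush (norm_le_one_of_mem_unitary)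
open Summit.QuantumFields.BalabanUV.T4Continuum.VariationalColourTower (Rtrv)
open Summit.QuantumFields.BalabanUV.T4Continuum.VariationalColourTaxiTransport
open Summit.QuantumFields.BalabanUV.T4Continuum.VariationalVectorFederbush (lineT)
open Summit.QuantumFields.BalabanUV.T4Continuum.CovariantAveragingTower (TowerLimitRate)
open Summit.QuantumFields.BalabanUV.T4Continuum.VectorBlockTrialForm (nsqV nsqV_nonneg QvL roughV kappaV)
open Summit.QuantumFields.BalabanUV.T4Continuum.VariationalVectorForm (ScV SfV qWV qVV lamV lamV_nonneg ScV_nonneg)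
open Summit.QuantumFields.BalabanUV.T4Continuum.VariationalVectorEffective (unc effV)
open Summit.QuantumFields.BalabanUV.T4Continuum.VariationalVectorTower (Gtr QmL)
open Summit.QuantumFields.BalabanUV.T4Continuum.VariationalVectorEndOfLeaves (eV ePV)
open Summit.QuantumFields.BalabanUV.T4Continuum.VariationalVectorWeitzenbock (divSq)
open Summit.QuantumFields.BalabanUV.T4Continuum.VariationalVectorGaugeSlice (avgOp projG projG_nonneg)
open Summit.QuantumFields.BalabanUV.T4Continuum.VariationalVectorGaugeSliceTower (Gtr_pullback)
open Summit.QuantumFields.BalabanUV.T4Continuum.VariationalVectorRegularityCovariant (GmProj GmProj_posSemidef projG_eq_qform)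
open Summit.QuantumFields.BalabanUV.T4Continuum.SliceComplementFlatGap (deltaGap)
open Summit.QuantumFields.BalabanUV.T4Continuum.CompositeFibreMismatch (mismatch_twoStepTaxi_class)
open Summit.QuantumFields.BalabanUV.T4Continuum.VariationalColourTaxiTowerEndAvgG (towerLimitRate_effV_taxiTower_avgG_of_class)
open Summit.QuantumFields.BalabanUV.T4Continuum.VariationalColourTaxiTowerAvgGData (hAVGG_projG_nestLv)
open Summit.QuantumFields.BalabanUV.T4Continuum.VariationalColourTaxiTowerAvgGDecay (epsAvgG_le_of_class epsAvgG_nonneg)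
open Summit.QuantumFields.BalabanUV.T4Continuum.VariationalColourTaxiTowerAvgGReg (hREGf_projG_taxi)
open Summit.QuantumFields.BalabanUV.T4Continuum.VariationalColourTaxiTowerProjGAvgGRate (towerLimitRate_effV_taxiTower_projG_avgG_of_class)
open Summit.QuantumFields.BalabanUV.T4Continuum.VariationalColourTaxiClassReadings (kappa_gammaF_le_of_class)
open Summit.QuantumFields.BalabanUV.T4Continuum.VariationalColourTaxiTowerOneMinDecay (oneMin_taxi_decay LambdaSucc_le_of_class)
open Summit.QuantumFields.BalabanUV.T4Continuum.VariationalColourScalarPair (Scv Sfv qWv qVv Qkv Q1v)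
open Summit.QuantumFields.BalabanUV.T4Continuum.VariationalColourUpperBound (nsqv)
open Summit.QuantumFields.BalabanUV.T4Continuum.VariationalColourOneStepPhys (rhov)
open Summit.QuantumFields.BalabanUV.T4Continuum.VariationalVectorOneStepPhys (rhoV)

variable {d : ℕ}
variable (L : ℕ) [NeZero L] (M : Fin d → ℕ) [hM : ∀ μ, NeZero (M μ)]
variable {R' : (k : ℕ) → Tor (fine L (fine (L ^ k) M)) → Fin d → (ℂ →L[ℂ] ℂ)}

/-! ## §1 Two per-level smallness readings -/

omit [NeZero L] hM in
/-- `2·40·(d·x) ≤ 1` from `x ≤ c` and `80(dc) ≤ 1`. [folklore] -/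
theorem small80_of_class {x c : ℝ} (hx : x ≤ c) (hsm4 : 80 * ((d : ℝ) * c) ≤ 1) : 2 * 40 * ((d : ℝ) * x) ≤ 1 := by
  have hd0 : (0 : ℝ) ≤ d := Nat.cast_nonneg d
  have h := mul_le_mul_of_nonneg_left hx hd0
  linarith

omit [NeZero L] hM in
/-- the level-(k+1) rough-Poincaré smallness written with `b_k`: `2d((L^{k+1})((d−1)(L^{k+1}−1)b_k))² ≤ ½` from `(L^{k+1})²b_k ≤ c` and `hsm2`. [folklore] -/
theorem smallP_succ_of_class (k : ℕ) {b c : ℝ} (hb0 : 0 ≤ b) (hbc : (((L ^ (k + 1) : ℕ)) : ℝ) ^ 2 * b ≤ c)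
    (hsm2 : 2 * (d : ℝ) * ((((d - 1 : ℕ) : ℝ)) * c) ^ 2 ≤ 1 / 2) :
    2 * (d : ℝ) * ((((L ^ (k + 1) : ℕ) : ℝ)) * (((d - 1 : ℕ) : ℝ) * ((L ^ (k + 1) - 1 : ℕ) : ℝ) * b)) ^ 2 ≤ 1 / 2 := by
  have hD0 : (0 : ℝ) ≤ ((d - 1 : ℕ) : ℝ) := Nat.cast_nonneg _
  have hn1r : ((L ^ (k + 1) - 1 : ℕ) : ℝ) ≤ ((L ^ (k + 1) : ℕ) : ℝ) := by exact_mod_cast Nat.sub_le (L ^ (k + 1)) 1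
  have hx0 : 0 ≤ (((L ^ (k + 1) : ℕ) : ℝ)) * (((d - 1 : ℕ) : ℝ) * ((L ^ (k + 1) - 1 : ℕ) : ℝ) * b) := by positivity
  have hx : (((L ^ (k + 1) : ℕ) : ℝ)) * (((d - 1 : ℕ) : ℝ) * ((L ^ (k + 1) - 1 : ℕ) : ℝ) * b) ≤ ((d - 1 : ℕ) : ℝ) * c := by
    calc (((L ^ (k + 1) : ℕ) : ℝ)) * (((d - 1 : ℕ) : ℝ) * ((L ^ (k + 1) - 1 : ℕ) : ℝ) * b)
        = ((d - 1 : ℕ) : ℝ) * ((((L ^ (k + 1) : ℕ) : ℝ) * ((L ^ (k + 1) - 1 : ℕ) : ℝ)) * b) := by ring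
      _ ≤ ((d - 1 : ℕ) : ℝ) * ((((L ^ (k + 1) : ℕ) : ℝ) * ((L ^ (k + 1) : ℕ) : ℝ)) * b) :=
          mul_le_mul_of_nonneg_left (mul_le_mul_of_nonneg_right (mul_le_mul_of_nonneg_left hn1r (Nat.cast_nonneg _)) hb0) hD0
      _ = ((d - 1 : ℕ) : ℝ) * ((((L ^ (k + 1) : ℕ)) : ℝ) ^ 2 * b) := by ring
      _ ≤ ((d - 1 : ℕ) : ℝ) * c := mul_le_mul_of_nonneg_left hbc hD0
  have h2 := pow_le_pow_left₀ hx0 hx 2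
  exact (mul_le_mul_of_nonneg_left h2 (by positivity)).trans hsm2

/-! ## §2 The END -/

/-- **THE VECTOR END WITH RATE AT BAŁABAN's TAXI DATA FOR THE COVARIANT PROJECTED GAUGE FUNCTIONAL — NO (ONE-min) LEAF DISPLAYED.**  File 4's END with its
(ONE-min)_k socket INHABITED by leaf-04-g7's `hONEm_taxi` at `ρV := ScV(G_k ·) + nsqV ∘ Q_k`, `C_R = 1`, the costs' decay by file 8, the transfer smallness by `hsmV`,
`hsmG`, the class lines by the package ∕ §1 ∕ files 6, 8; DISPLAYED: file 4's data classes + `hsm7`, `hsmV`, `hsmG` + the colour scalar pair's five leaves at the taxi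
frames (uniform constants; SUPPLIED from data by the next file `VariationalColourTaxiTowerProjGRateData`). [folklore] -/
theorem towerLimitRate_effV_taxiTower_projG_of_class (hL : 2 ≤ L) (hd : 1 ≤ d) (hM2 : ∀ μ, 1 < M μ)
    -- the one-step bond data: unitary, plaquette class, coherent
    (hU : ∀ k x μ, R' k x μ ∈ unitary (ℂ →L[ℂ] ℂ)) {b : ℕ → ℝ} {c : ℝ}
    (hb : ∀ k x κ ι, ‖R' k x κ * R' k (x + unitVec (fine L (fine (L ^ k) M)) κ) ι - R' k x ι * R' k (x + unitVec (fine L (fine (L ^ k) M)) ι) κ‖ ≤ b k)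
    (hbc : ∀ k, (((L ^ (k + 1) : ℕ)) : ℝ) ^ 2 * b k ≤ c)
    (hcoh : ∀ k, coarseTv L (fine (L ^ (k + 1)) M) (R' (k + 1)) = Rtrv (L ^ k) L M (R' k))
    -- the polynomial smallness of the class constant (parts 6–8's four + the two-step frames' class + FED⁺'s absorption)
    (hsm1 : 60 * (6 : ℝ) ^ (d - 1) * ((2 * ((((d - 1 : ℕ) : ℝ) + (d : ℝ) * d)) + 3 * ((d - 1 : ℕ) : ℝ)) * c) ≤ 1 / 2)
    (hsm2 : 2 * (d : ℝ) * ((((d - 1 : ℕ) : ℝ)) * c) ^ 2 ≤ 1 / 2) (hsm3 : 64 * (2 * ((((d - 1 : ℕ) : ℝ) + (d : ℝ) * d) * c)) ^ 2 ≤ 1)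
    (hsm4 : 80 * ((d : ℝ) * c) ≤ 1) (hsm5 : 2 * (d : ℝ) * (3 * ((d - 1 : ℕ) : ℝ) * L * c) ^ 2 ≤ 1 / 2) (hsm6 : 64 * (d : ℝ) * ((((d - 1 : ℕ) : ℝ)) * c) ^ 2 ≤ 1 / 2)
    -- the DISPLAYED regular presentation of the tower's unit-lattice bond fields and the numeric smallness replacing (GF3)
    {ar ℓr : ℕ → ℝ} {α lam : ℝ} (har0 : ∀ k, 0 ≤ ar k) (har : ∀ k x μ, ‖Rlev L M R' k x μ - 1‖ ≤ ar k)
    (hℓr : ∀ k x μ, ‖Rlev L M R' k x μ - Rlev L M R' k (x - unitVec (fine (L ^ k) M) μ) μ‖ ≤ ℓr k)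
    (hα : ∀ k, (((L ^ k : ℕ)) : ℝ) * ar k ≤ α) (hlam : ∀ k, (((L ^ k : ℕ)) : ℝ) ^ 2 * ℓr k ≤ lam)
    (hsmallδ : (18 * (d * ((d + 1 : ℝ) * Cst d 1)) + 6) * deltaGap d 1 α lam (d * α) (((d - 1 : ℕ) : ℝ) * c) ^ 2 ≤ 1 / 2)
    (hsmallQ : ((d + 1 : ℝ) * Cst d 1) * (7 * (d * α ^ 2) + 2 * (2 * ((((d - 1 : ℕ) : ℝ) + (d : ℝ) * d) * c) + (d * α + α)) ^ 2) ≤ 1 / 2)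
    -- the effective-operator parameter and the rate (`0 < θ < 1`, `θ² ≥ L⁻¹`: the half exponent of the harmonic-approximation defect inside (G″))
    {aa : ℝ} (haa : 0 < aa) {θ : ℝ} (hθ0 : 0 < θ) (hθL : (L : ℝ)⁻¹ ≤ θ ^ 2) (hθ1 : θ < 1)
    -- file 6's `hcF` line and the two (ONE-min) transfer smallness lines (`v ≤ ⅛`, `γ ≤ ¼` under the class; polynomial in `c`)
    (hsm7 : 60 * (6 : ℝ) ^ (d - 1) * ((2 * ((((d - 1 : ℕ) : ℝ)) + (d : ℝ) * d) + 5 * ((d - 1 : ℕ) : ℝ)) * c) ≤ 1 / 2)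
    (hsmV : (2 * ((4 * ((d : ℝ) * ((d : ℝ) * c)) * (4 * d * (36 : ℝ) ^ d * (1 + 3 * ((d - 1 : ℕ) : ℝ) * L * c) ^ 2)) ^ 2 * ((d : ℝ) * ((2 * (1 + (36 * (d * ((d + 1 : ℝ) * Cst d 1)) + 8))) + (2 * ((24 * (d * ((d + 1 : ℝ) * Cst d 1)) + 4) + d * c * 64)))))) ≤ 1 / 8)
    (hsmG : ((3 * (((d - 1 : ℕ) : ℝ) * c)) ^ 2 * (max (40 * (2 * (1 + (36 * (d * ((d + 1 : ℝ) * Cst d 1)) + 8)))) (64 + 40 * (2 * ((24 * (d * ((d + 1 : ℝ) * Cst d 1)) + 4) + d * c * 64))))) ≤ 1 / 4)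
    -- the DISPLAYED colour scalar pair's leaves at the taxi frames, every level, uniform constants (supplier: leaf-04-g7's `colour_pair_closed` chain at taxi frames)
    {Λc CPc CRc : ℝ} (hΛc : 0 ≤ Λc) (hCPc : 0 ≤ CPc) (hCRc : 0 ≤ CRc)
    (hUBc : ∀ k, ∀ ψ : Tor M → ℂ, ∃ f, Qkv (L ^ k) M (taxiTv (L ^ k) M (Rlev L M R' k)) f = ψ ∧ Scv (L ^ k) M (Rlev L M R' k) f ≤ Λc * nsqv ψ)
    (hUBf : ∀ k, ∀ ψ : Tor M → ℂ, ∃ g, Qkv (L ^ k) M (taxiTv (L ^ k) M (Rlev L M R' k)) (Q1v (L ^ k) L M (taxiTv L (fine (L ^ k) M) (R' k)) g) = ψ ∧ Sfv (L ^ k) L M (R' k) g ≤ Λc * nsqv ψ)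
    (hPcc : ∀ k, ∀ f, qWv (L ^ k) M f ≤ CPc * (Scv (L ^ k) M (Rlev L M R' k) f + nsqv (Qkv (L ^ k) M (taxiTv (L ^ k) M (Rlev L M R' k)) f)))
    (hPf : ∀ k, ∀ g, qVv (L ^ k) L M g ≤ CPc * (Sfv (L ^ k) L M (R' k) g + nsqv (Qkv (L ^ k) M (taxiTv (L ^ k) M (Rlev L M R' k)) (Q1v (L ^ k) L M (taxiTv L (fine (L ^ k) M) (R' k)) g))))
    (hREGc : ∀ k, ∀ (ψ : Tor M → ℂ) f, Qkv (L ^ k) M (taxiTv (L ^ k) M (Rlev L M R' k)) f = ψ → (∀ f₂, Qkv (L ^ k) M (taxiTv (L ^ k) M (Rlev L M R' k)) f₂ = ψ → Scv (L ^ k) M (Rlev L M R' k) f ≤ Scv (L ^ k) M (Rlev L M R' k) f₂) →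
      rhov (L ^ k) M (Rlev L M R' k) f ≤ CRc * (Scv (L ^ k) M (Rlev L M R' k) f + nsqv ψ)) :
    -- the constants: part 8's G-side constants, file 3's V-REG′ sum, file 2b's (G″) decay constant
    let CDs : ℝ := 36 * (d * ((d + 1 : ℝ) * Cst d 1)) + 8
    let CDs' : ℝ := 24 * (d * ((d + 1 : ℝ) * Cst d 1)) + 4
    let Λs : ℝ := 4 * lamV d (((d - 1 : ℕ) : ℝ) * c) (d : ℝ) 0
    let κs : ℝ := 2 * (1 + CDs)
    let κs' : ℝ := 2 * (CDs' + (d : ℝ) * c * 64)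
    let CPs : ℝ := max (40 * κs) (64 + 40 * κs')
    let RPs : ℝ := 4 * d * (36 : ℝ) ^ d * (1 + ((d - 1 : ℕ) : ℝ) * c) ^ 2
    let CRvs : ℝ := 8 * Λs + 2 * d * c * (κs + κs') + (8 * RPs ^ 2 + 5 * (d : ℝ) ^ 2 * c ^ 2) * CPs
    let CRs' : ℝ := CRvs + κs + κs' + CPs + CDs + CDs'
    let Λcs : ℝ := 2 * d * (36 : ℝ) ^ d * ((4 + ((d - 1 : ℕ) : ℝ) * c) ^ 2 + 9)
    let CRHs : ℝ := 2 * Λcs + 2 * d * c + (d : ℝ) ^ 2 * c ^ 2 * 136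
    let ε₁s : ℝ := ((d : ℝ) / 4 + 1 / 2) * L
    let δ's : ℝ := Real.sqrt (2 * d * (1 + (d : ℝ) ^ 2)) * (2 * ((d - 1 : ℕ) : ℝ) * L * c)
    let ΛHs : ℝ := Λcs + (ε₁s * CRHs + 2 * δ's * Real.sqrt ((1 + ε₁s * CRHs) * 136) + δ's ^ 2 * 136) * (Λcs + 1)
    let EHs : ℝ := ePV ΛHs 136 CRHs ε₁s δ's + eV ΛHs 136 (Real.sqrt d * (((d - 1 : ℕ) : ℝ) * c))
    let Cε : ℝ := Real.sqrt (3 * d) * (2 + 2 * (((d - 1 : ℕ) : ℝ) * c)) + Real.sqrt (136 * EHs) + 4 * (d : ℝ) ^ 2 * c * RPs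
    -- the (ONE-min) decay constants of files 7 ∕ 8 at the (GF3) constants, the colour pair's and part 8's `CRvs`
    let EH1 : ℝ := ((((d : ℝ) / 4 + 1 / 2) * L) * CRc * (Λc + 1)
          + 2 * (Real.sqrt (2 * d * (1 + (d : ℝ) ^ 2)) * (L * (2 * ((d - 1 : ℕ) : ℝ) * c))) * Real.sqrt ((Λc + (((d : ℝ) / 4 + 1 / 2) * L) * CRc * (Λc + 1)) * (CPc * (Λc + 1)))
          + (Real.sqrt (2 * d * (1 + (d : ℝ) ^ 2)) * (L * (2 * ((d - 1 : ℕ) : ℝ) * c))) ^ 2 * (CPc * (Λc + 1))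
          + 2 * (Real.sqrt d * (((d - 1 : ℕ) : ℝ) * c)) * Real.sqrt (Λc * (CPc * (Λc + 1))))
    let E21 : ℝ := (1 + 6 * ((8 * d * (CRvs + (1 + (2 * ((d - 1 : ℕ) : ℝ) * c)) ^ 2 * ((d : ℝ) / 4 * L * CRvs) + (2 * ((d - 1 : ℕ) : ℝ) * c) ^ 2 * ((2 * (1 + CDs)) + (2 * (CDs' + d * c * 64))) + 2 * (1 + (d : ℝ) ^ 2) * (L : ℝ) ^ 2 * ((2 * ((d - 1 : ℕ) : ℝ) * c) ^ 2 * (max (40 * (2 * (1 + CDs))) (64 + 40 * (2 * (CDs' + d * c * 64))))))) + ((d : ℝ) / 2 * (2 * d * CRvs + 2 * (d : ℝ) ^ 2 * (c ^ 2 * (max (40 * (2 * (1 + CDs))) (64 + 40 * (2 * (CDs' + d * c * 64))))))) + ((d : ℝ) / 4 * (2 * (2 * d * CRvs + 2 * (d : ℝ) ^ 2 * (c ^ 2 * (max (40 * (2 * (1 + CDs))) (64 + 40 * (2 * (CDs' + d * c * 64)))))) + 2 * (Λc * (CDs + CDs')))) + (CPc * EH1 * (CDs + CDs'))))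
    let EPS1 : ℝ := (1 + 2 * ((1 + 2 * (d * (L : ℝ))) * (1 + CRvs) + E21) + 2 * ((4 * lamV d (((d - 1 : ℕ) : ℝ) * (3 * L * c)) (d : ℝ) 0) * (25 / 4 * ((2 * (1 + CDs)) + (2 * (CDs' + d * c * 64))))))
    let V1 : ℝ := (2 * ((4 * ((d : ℝ) * ((d : ℝ) * c)) * (4 * d * (36 : ℝ) ^ d * (1 + 3 * ((d - 1 : ℕ) : ℝ) * L * c) ^ 2)) ^ 2 * ((d : ℝ) * ((2 * (1 + CDs)) + (2 * (CDs' + d * c * 64))))))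
    let G1 : ℝ := ((3 * (((d - 1 : ℕ) : ℝ) * c)) ^ 2 * (max (40 * (2 * (1 + CDs))) (64 + 40 * (2 * (CDs' + d * c * 64)))))
    let DPR1 : ℝ := (Real.sqrt (8 * d * (1 + (d : ℝ) ^ 2)) * (L * (2 * ((d - 1 : ℕ) : ℝ) * c)))
    let p1 : ℝ := (1 + 2 * ((4 * lamV d (((d - 1 : ℕ) : ℝ) * c) (d : ℝ) 0) * G1) * (1 + 4 * G1))
    let As1 : ℝ := (1 + p1) * (1 + 4 * V1) * 2
    let Cε1 : ℝ := (1 + 2 * p1 + 8 * V1 + 8 * p1 * V1) + As1 * EPS1 + (4 * V1 * ((1 + p1) * (1 + 4 * V1)) + 8 * ((4 * lamV d (((d - 1 : ℕ) : ℝ) * c) (d : ℝ) 0) * G1))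
    let Cδ1 : ℝ := Real.sqrt As1 * DPR1
    TowerLimitRate (ι := fun _ => Tor M × Fin d) (fun _ => (1 : Matrix (Tor M × Fin d) (Tor M × Fin d) ℂ)) 1
      (fun k => effV (L ^ k) M (Rlev L M R' k)
        (GmProj (fine (L ^ k) M) (Rlev L M R' k) (LinearMap.ker (avgOp (L ^ k) M (taxiTv (L ^ k) M (Rlev L M R' k))))) (QmL (L ^ k) M (nestLv L M R' k)) aa)
      (eV Λs (CPs + CRs') (2 * d * ((d : ℝ) * c + L * c) + Cε) + ePV Λs CPs 1 Cε1 Cδ1) θ := by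
  intro CDs CDs' Λs κs κs' CPs RPs CRvs CRs' Λcs CRHs ε₁s δ's ΛHs EHs Cε EH1 E21 EPS1 V1 G1 DPR1 p1 As1 Cε1 Cδ1
  have hL1 : 1 ≤ L := le_trans (by norm_num) hL
  have hθ1' : θ ≤ 1 := hθ1.le
  have hd0 : (0 : ℝ) ≤ d := Nat.cast_nonneg d
  have hCst := Literature.MathematicalPhysics.QuantumFieldTheory.Balaban1983to89.B5Prop11Lower.one_le_Cst (d := d) (1 : ℝ)
  have hCDs0 : (0 : ℝ) ≤ CDs := by show (0 : ℝ) ≤ 36 * (d * ((d + 1 : ℝ) * Cst d 1)) + 8; positivity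
  have hCDs0' : (0 : ℝ) ≤ CDs' := by show (0 : ℝ) ≤ 24 * (d * ((d + 1 : ℝ) * Cst d 1)) + 4; positivity
  have hb0 : ∀ k, 0 ≤ b k := fun k => (norm_nonneg _).trans (hb k 0 ⟨0, hd⟩ ⟨0, hd⟩)
  -- the class package with the (GF1′) constants of `projG`: `C_G = d`, `C₀ = 0`
  obtain ⟨a, ha0, ha, hac, hκγ, hsmallP, hγs, -, hΛk⟩ := taxiClassPackage L M hL hd hU hb hbc hsm1 hsm2 hsm3 (CG := fun _ => (d : ℝ)) (C₀ := fun _ => 0)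
    (CGs := (d : ℝ)) (c₀ := 0) (fun _ => Nat.cast_nonneg d) (fun _ => le_rfl) (fun _ => le_rfl) (fun _ => by simp)
  have hc0 : 0 ≤ c := le_trans (by have := ha0 0; positivity) (hac 0)
  -- (GF3) at every level (part 7) and the G-side sockets (part 8)
  have hGdiv : ∀ k W, ((((L ^ k : ℕ) : ℝ)) ^ d)⁻¹ * ((((L ^ k : ℕ) : ℝ)) ^ 2 * divSq (fine (L ^ k) M) (Rlev L M R' k) W)
      ≤ CDs * ScV (L ^ k) M (Rlev L M R' k) (projG (fine (L ^ k) M) (Rlev L M R' k) (LinearMap.ker (avgOp (L ^ k) M (taxiTv (L ^ k) M (Rlev L M R' k))))) W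
        + CDs' * nsqV M (QvL (L ^ k) M (nestLv L M R' k) W) := fun k W =>
    hGdiv_projG_nestLv_regular L M hL hU hb hbc hcoh hd hM2 k (ha0 k) (ha k) (hac k) (har0 k) (har k) (hℓr k) (hα k) (hlam k) hsmallδ hsmallQ W
  obtain ⟨-, -, -, hREGv⟩ := projG_sockets_nestLv L M hd hM2 hU hb hcoh ha0 ha hac hκγ hsmallP hγs hΛk hsm4 hCDs0 hCDs0' hGdiv
  -- nonnegativity of part 8's V-REG constant
  have hκs0 : (0 : ℝ) ≤ κs := mul_nonneg zero_le_two (add_nonneg zero_le_one hCDs0)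
  have hκs0' : (0 : ℝ) ≤ κs' := mul_nonneg zero_le_two (add_nonneg hCDs0' (by positivity))
  have hΛs0 : 0 ≤ Λs := mul_nonneg (by norm_num) (lamV_nonneg (Nat.cast_nonneg d) (by positivity))
  have hCPs0 : 0 ≤ CPs := le_max_of_le_left (mul_nonneg (by norm_num) hκs0)
  have hd2c2 : (0 : ℝ) ≤ 5 * (d : ℝ) ^ 2 * c ^ 2 := by positivity
  have hCRvs0 : 0 ≤ CRvs :=
    add_nonneg (add_nonneg (mul_nonneg (by norm_num) hΛs0) (mul_nonneg (mul_nonneg (mul_nonneg zero_le_two hd0) hc0) (add_nonneg hκs0 hκs0')))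
      (mul_nonneg (add_nonneg (mul_nonneg (by norm_num) (sq_nonneg RPs)) hd2c2) hCPs0)
  -- the per-level class lines `hONEm_taxi` wants
  have h80 : ∀ k, 2 * 40 * ((d : ℝ) * ((((L ^ k : ℕ) : ℝ)) ^ 2 * a k)) ≤ 1 := fun k => small80_of_class (d := d) (hac k) hsm4
  have h80' : ∀ k, 2 * 40 * ((d : ℝ) * ((((L ^ (k + 1) : ℕ) : ℝ)) ^ 2 * b k)) ≤ 1 := fun k => small80_of_class (d := d) (hbc k) hsm4
  have hsmall1 : ∀ k, 2 * (d : ℝ) * ((((L ^ (k + 1) : ℕ) : ℝ)) * (((d - 1 : ℕ) : ℝ) * ((L ^ (k + 1) - 1 : ℕ) : ℝ) * b k)) ^ 2 ≤ 1 / 2 :=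
    fun k => smallP_succ_of_class (d := d) L k (hb0 k) (hbc k) hsm2
  have hc1 := fun k => lt_of_le_of_lt (LambdaSucc_le_of_class (d := d) L hL hd hb0 hbc hsm1 k).1 (by norm_num : (1 : ℝ) / 2 < 1)
  have hcF1 := fun k => lt_of_le_of_lt ((kappa_gammaF_le_of_class (d := d) L hL hd ha0 hb0 hac hbc k).trans hsm7) (by norm_num : (1 : ℝ) / 2 < 1)
  have hτ : ∀ k : ℕ, 0 < θ ^ k := fun k => pow_pos hθ0 k
  -- the (ONE-min) costs at taxi data and their decay (file 8)
  have hF8 := fun k => oneMin_taxi_decay (d := d) L hL hd ha0 hb0 hac hbc hsm1 hsm7 hθ0 hθ1' hθL hCDs0 hCDs0' hCDs0 hCDs0' hΛc hCPc hCRc hCRvs0 k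
  have hv8 := fun k => (hF8 k).2.2.1.trans hsmV
  have hγ4 := fun k => (hF8 k).2.2.2.1.trans hsmG
  -- file 4, fed with `hONEm_taxi` at `ρV := ScV + nsqV ∘ Q`, `C_R = 1`
  exact towerLimitRate_effV_taxiTower_projG_avgG_of_class L M hL hd hM2 hU hb hbc hcoh hsm1 hsm2 hsm3 hsm4 hsm5 hsm6 har0 har hℓr hα hlam hsmallδ hsmallQ
    haa hθ0.le hθL hθ1 (fun _ => (1 : ℝ)) _ _ (fun _ => zero_le_one) (fun _ => le_rfl)
    (fun k => (hF8 k).2.2.2.2.1) (fun k => (hF8 k).2.2.2.2.2.2.1) (fun k => (hF8 k).2.2.2.2.2.1) (fun k => (hF8 k).2.2.2.2.2.2.2)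
    (ρV := fun k W => ScV (L ^ k) M (Rlev L M R' k) (projG (fine (L ^ k) M) (Rlev L M R' k) (LinearMap.ker (avgOp (L ^ k) M (taxiTv (L ^ k) M (Rlev L M R' k))))) W
      + nsqV M (QvL (L ^ k) M (nestLv L M R' k) W))
    (fun k W => add_nonneg (ScV_nonneg (L ^ k) M _ (projG_nonneg _ _ _) W) (nsqV_nonneg M _))
    (fun k φ W₀ hW₀ hmin => by
      subst hW₀
      exact hONEm_taxi L M hU hb hcoh hd hM2 k (ha0 k) (ha k) (hb0 k) (hsmallP k) (hγs k) (h80 k) (hsmall1 k) (hγs (k + 1)) (h80' k) (hc1 k) (hcF1 k)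
        hCDs0 hCDs0' hCDs0 hCDs0' (hGdiv k) (hGdiv (k + 1)) hΛc hCPc hCRc (hUBc k) (hUBf k) (hPcc k) (hPf k) (hREGc k) hCRvs0 (hREGv k)
        (hτ k) (hτ k) (hτ k) (hτ k) (hτ k) (hv8 k) (hγ4 k) _ W₀ rfl hmin)
    (fun k φ W hW _ => by subst hW; exact le_of_eq (one_mul _).symm)

end Summit.QuantumFields.BalabanUV.T4Continuum.VariationalColourTaxiTowerProjGRate

end
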